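import Summits.BirchSwinnertonDyer.BirchSwinnertonDyer.Theorems.EisensteinPrimesKatzLineFactor
import Summits.BirchSwinnertonDyer.BirchSwinnertonDyer.Theorems.EisensteinPrimesKatzLineFirstUnitIndex
import Summits.BirchSwinnertonDyer.BirchSwinnertonDyer.Theorems.EisensteinPrimesTwoVariableSliceUnitContent
import HarnessLib

/-!
# AN-F₁ (θ_K-explicit form): the anticyclotomic line of a two-variable de Shalit frame of `θ_K⁻¹` IS a
# CGLS-type frame of `θ_K` over the wide receptacle `𝓞_{ℂ_p}⟦T⟧`, with its first unit coefficient at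
# `ord(g(S=0) mod p)`
# (helper file for crux 2 `GoodLatticeBDPValue`, stmt-BirchSwinnertonDyer-19032, line `halves`, stub 3
# `stub_anDS`, piece AN-F₁ `KatzLineIntFrameAt` of `Cruxes/GoodLatticeBDPValue/Lines/halves_anDS_split_idea11g4.lean`
# rev 2; seat `bsd-line-x1-p1-w2` gen 2)

THE STATEMENT PROVED (`exists_katzLineIntFrame`). `K` imaginary quadratic (CM), `2 < p = v v̄` split with
`v` read through `ι'`, `κ` anticyclotomic with topological generator `γ`, `(κ, κ'; γ, γ')` a generator pair,
`θ_K` a Hecke character of FINITE ORDER, `c`-INVARIANT, UNRAMIFIED AT `v` AND `v̄`, `S` its exact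
ramification set, de Shalit period data `Ω ≠ 0`, `δ² = ±D_K`, `Ω_p ∈ R₀ˣ`, a two-variable frame
`IsKatzMeasure₂ ι' v v̄ S κ κ' γ⁻¹ γ'⁻¹ θ_K⁻¹ Ω δ Ω_p G`, a structure map `J : ℤ_p → 𝓞_{ℂ_p}`, `g ∈ ℤ_p⟦S⟧⟦T⟧`
with `J(g) ~ G` and `g(S=0) mod p ≠ 0`. GRANTED de Shalit II.6.4 (`thmII64_katzMeasure₂_functionalEquation`,
PUBLISHED, a hypothesis): there are `Ω_K' ≠ 0` (`= Ω`), `Ω_p' ∈ ℂ_p` with `‖Ω_p'‖ = 1` and `Q ∈ 𝓞_{ℂ_p}⟦T⟧`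
such that (i) for every `φ` unramified everywhere of type `(n, −n)`, `0 < n`, `p − 1 ∣ n`, every entire
continuation `hL` of `L(θ_Kφ, ·)` and every avatar `r` of `φ` through `κ`:
`Q(r(γ) − 1) = ι'⁻¹(katzInterpolationValue p θ_K v v̄ ∅ φ n Ω_K' (hL.continuation 1))·Ω_p'^{2n}` — the body of
`CastellaGrossiLeeSkinner2022.IsKatzLFunction` with `𝓞_{ℂ_p}⟦T⟧` for `R₀⟦T⟧` (the idea file's
`IsKatzLFunctionInt`), and (ii) `‖[T^{n₀}]Q‖ = 1 ∧ ∀ i < n₀, ‖[T^i]Q‖ < 1` for `n₀ = ord(g(S=0) mod p)` (the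
idea file's `IntFirstUnitCoeffAt`). This is `KatzLineIntFrameAt` with the residual-pair plumbing
(`θquot ↦ θ_K` finite-order, `c`-invariant, unramified at `p`) left as displayed hypotheses.

ROUTE. (F) `thmII64_….anticyclotomicLine_left` at the unit generator pair `(κ, κ'; γ⁻¹, γ'⁻¹)` gives the
reflected one-variable branch `Q♭ = Ǧ(·,0)` of `reflect θ_K⁻¹ = θ_K‖·‖` along `κ` at `γ⁻¹`, over `c • S = S`,
with `G(·,0)(x) = C·r(g₀)·Q♭(x)`; §1 `hasValueAt_C_mul_of_isKatzBranch_reflect_inv` reads `Q♭` at the datum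
`(φ⁻¹, r⁻¹, n+1, n−1, hL♭)` (admissible: `…KatzBranchSupply`, `…KatzLineFactor` §1–§2) and converts the
value with THE FACTOR (`…KatzLineFactor` §4) and the `L`-value identity: `Q := C(ι'⁻¹(4ζ⁻¹))·Q♭`,
`Ω_p' := Ω_p·w⁻¹`, `w² = ι'⁻¹ζ`; §2 supplies `w`, the constant and their norms (`ζ⁴ = 1`, `p` odd); §3 reads
the first-unit index: `G(·,0) = C·(1+T)^a·Q♭` (`IwasawaTwoVariable.eq_C_mul_binomial_mul_of_relation`) and
`J(g(·,0)) ~ G(·,0)`, so `Q`, `Q♭`, `G(·,0)`, `J(g(·,0))` all have first unit coefficient at `ord(g(·,0) mod p)`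
(`…KatzLineFirstUnitIndex`).

HONEST FRAMING: a CONDITIONAL on one published theorem stated as a named fact (de Shalit II.6.4); no
definition, no `sorry`; nothing about BSD, IMC2 or KY Thm. 3.0.8 is proved; `Q` is NOT claimed
`R₀`-valued (that is AN-F₂'s business). References: de Shalit 1987 II.4.16 (50), II.6.1, II.6.4; CGLS 2022
Thm. 2.1.2; Kriz 2016 Thm. 27; Katz 1978 (5.3.5); Washington 1997 §7.1.
-/

-- the summit namespace `Summit.BirchSwinnertonDyer.BirchSwinnertonDyer` repeats the problem name by design (D-0017)
set_option linter.dupNamespace false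
set_option autoImplicit false

noncomputable section

open scoped Classical Topology

open Filter NumberField IsDedekindDomain Field PowerSeries Literature.NumberTheory.EllipticCurves
  Literature.NumberTheory.GaloisRepresentations Literature.NumberTheory.GaloisRepresentations.HeckeCharacter
  Literature.NumberTheory.Automorphic
  Literature.NumberTheory.EllipticCurves.CastellaGrossiLeeSkinner2022
  Literature.NumberTheory.EllipticCurves.Rubin1991 Literature.NumberTheory.EllipticCurves.DeShalit1987
  Literature.NumberTheory.EllipticCurves.Hida2010MuInvariant
  Summit.BirchSwinnertonDyer.Rank1Residual.X11b Summit.BirchSwinnertonDyer.Rank1Residual.X11b.Three.LambdaSupply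
  Summit.BirchSwinnertonDyer.BirchSwinnertonDyer.Theorems.IwasawaTwoVariable

namespace Summit.BirchSwinnertonDyer.BirchSwinnertonDyer.Theorems.KatzLineFrame

variable {K : Type} [Field K] [NumberField K] [IsCMField K] {p : ℕ} [Fact p.Prime]

/-! ## §1 Frame transport: a reflected de Shalit branch at `γ⁻¹`, rescaled, has the CGLS values at `γ` -/

/-- **Frame transport.** Let `Q♭` be a de Shalit branch of `reflect θ_K⁻¹ = θ_K‖·‖` along the
anticyclotomic `κ` at `γ⁻¹` over the exact ramification set `S` of `θ_K` (finite order, `c`-invariant,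
unramified at `v`, `v̄`), with period data `(Ω, δ, Ω_p)`, `δ ≠ 0`. Let `ζ := (2πi/√D_K)/(2π/δ)`,
`w ∈ ℂ_p` with `w² = ι⁻¹ζ`, `w ≠ 0`, and `c₀ ∈ 𝓞_{ℂ_p}` with `c₀ = ι⁻¹(4ζ⁻¹)`. Then `C(c₀)·Q♭` takes, at
`r(γ) − 1` for every CGLS datum `(φ, n, hL, r)` (φ unramified everywhere of type `(n,−n)`, `1 ≤ n`, `r` its
avatar through `κ`), the CGLS value `ι⁻¹(katzInterpolationValue p θ_K v v̄ ∅ φ n Ω (L(θ_Kφ,1)))·(Ω_p w⁻¹)^{2n}`.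
(Read `Q♭` at the admissible datum `(φ⁻¹, r⁻¹, n+1, n−1, hL♭)`: `r⁻¹(γ⁻¹) = r(γ)`; `L(θ_K‖·‖φ⁻¹,0) =
L(θ_Kφ,1)`; THE FACTOR `CGLS(φ) = 4ζ^{n−1}·DS`; `ι⁻¹(4ζ^{n−1})·(Ω_p w⁻¹)^{2n}·ι⁻¹(ζ)·… = ι⁻¹(4ζ⁻¹)·Ω_p^{2n}`.)
[cite: deShalit1987, II.4.16 (49)–(50), II.6.1 (1)] [cite: CastellaGrossiLeeSkinner2022, Thm. 2.1.2 (arXiv:2008.02571v2 TeX L1015–1041)]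
[cite: Kriz2016, Thm. 27] [cite: Katz1978, Thm. (5.3.0) eq. (5.3.5)] -/
theorem hasValueAt_C_mul_of_isKatzBranch_reflect_inv (hK : IsImaginaryQuadratic K)
    {ι : PadicAlgCl p ≃+* ℂ} {v vbar : HeightOneSpectrum (𝓞 K)} (hv : ((p : ℕ) : 𝓞 K) ∈ v.asIdeal)
    (hvbar : ((p : ℕ) : 𝓞 K) ∈ vbar.asIdeal) (hne : vbar ≠ v)
    {θK : HeckeCharacter K} (hfin : θK.IsFiniteOrder)
    (hgal : HeckeCharacter.galConj (IsCMField.complexConj K) θK = θK)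
    (hθv : θK.IsUnramifiedAt v) (hθvbar : θK.IsUnramifiedAt vbar)
    {S : Finset (HeightOneSpectrum (𝓞 K))}
    (hS : ∀ w : HeightOneSpectrum (𝓞 K), w ∈ S ↔ ¬ θK.IsUnramifiedAt w)
    {κ : ZpExtension K p} (hκ : κ.IsAnticyclotomic) {γ : absoluteGaloisGroup K}
    {Ω δ : ℂ} (hδ : δ ≠ 0) {Ωp : ℂ_[p]} {Qb : PowerSeries 𝓞_ℂ_[p]}
    (hQ : IsKatzBranch ι v vbar S κ γ⁻¹ (reflect θK⁻¹) Ω δ Ωp Qb)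
    {w : ℂ_[p]} (hw : w ^ 2 = ((ι.symm ((2 * (Real.pi : ℂ) * Complex.I /
        ((NumberField.discr K : ℂ) ^ ((2 : ℂ)⁻¹))) / (2 * (Real.pi : ℂ) / δ)) : PadicAlgCl p) : ℂ_[p]))
    (hw0 : w ≠ 0) {c₀ : 𝓞_ℂ_[p]}
    (hc₀ : (c₀ : ℂ_[p]) = ((ι.symm (4 * ((2 * (Real.pi : ℂ) * Complex.I /
        ((NumberField.discr K : ℂ) ^ ((2 : ℂ)⁻¹))) / (2 * (Real.pi : ℂ) / δ))⁻¹) : PadicAlgCl p) : ℂ_[p]))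
    (φ : HeckeCharacter K) (n : ℕ) (hn : 0 < n)
    (hφunr : ∀ w : HeightOneSpectrum (𝓞 K), φ.IsUnramifiedAt w)
    (hφinf : φ.HasInfinityType (fun _ ↦ (n : ℤ)) (fun _ ↦ -(n : ℤ)))
    (hL : LFunction.HasEntireContinuation (heckeLFunction (θK * φ)))
    (r : FramedGaloisRep K (PadicAlgCl p) 1) (hr : IsPAdicAvatarOf ι φ r) (hκr : FactorsThroughZp κ r) :
    IntSeries.HasValueAt (PowerSeries.C c₀ * Qb) (avatarValueAt r γ - 1)
      (((ι.symm (katzInterpolationValue p θK v vbar ∅ φ n Ω (hL.continuation 1)) :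
          PadicAlgCl p) : ℂ_[p]) * (Ωp * w⁻¹) ^ (2 * n)) := by
  have hp : p.Prime := Fact.out
  have hn1 : 1 ≤ n := hn
  -- the atoms of the constant
  set ζ : ℂ := (2 * (Real.pi : ℂ) * Complex.I / ((NumberField.discr K : ℂ) ^ ((2 : ℂ)⁻¹))) /
    (2 * (Real.pi : ℂ) / δ) with hζ
  set Φ : ℂ →+* ℂ_[p] := (algebraMap (PadicAlgCl p) ℂ_[p]).comp (ι.symm : ℂ ≃+* PadicAlgCl p).toRingHom
    with hΦdef
  have hΦ : ∀ x : ℂ, ((ι.symm x : PadicAlgCl p) : ℂ_[p]) = Φ x := fun x ↦ rfl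
  -- `r = e ∘ ψ`, its inverse, `φ ∘ c = φ⁻¹`
  set ψ : absoluteGaloisGroup K →ₜ* (PadicAlgCl p)ˣ :=
    ((FramedRep.unitsContinuousMulEquivOfUnique (Fin 1) (PadicAlgCl p)).symm :
      GL (Fin 1) (PadicAlgCl p) →ₜ* (PadicAlgCl p)ˣ).comp r with hψ
  have hre : (FramedRep.unitsContinuousMulEquivOfUnique (Fin 1) (PadicAlgCl p) :
      (PadicAlgCl p)ˣ →ₜ* GL (Fin 1) (PadicAlgCl p)).comp ψ = r := by rw [hψ, comp_symm_comp_eq]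
  have hr' : IsPAdicAvatarOf ι φ ((FramedRep.unitsContinuousMulEquivOfUnique (Fin 1) (PadicAlgCl p) :
      (PadicAlgCl p)ˣ →ₜ* GL (Fin 1) (PadicAlgCl p)).comp ψ) := by rwa [hre]
  have hκr' : FactorsThroughZp κ ((FramedRep.unitsContinuousMulEquivOfUnique (Fin 1) (PadicAlgCl p) :
      (PadicAlgCl p)ˣ →ₜ* GL (Fin 1) (PadicAlgCl p)).comp ψ) := by rwa [hre]
  have hφc : HeckeCharacter.galConj (IsCMField.complexConj K) φ = φ⁻¹ :=
    galConj_complexConj_eq_inv_of_factorsThroughZp hK ι hκ hr hκr hφunr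
  -- the admissible datum `(φ⁻¹, e∘ψ⁻¹, n+1, n−1, hL♭)` on the reflected branch
  have hinv : IsPAdicAvatarOf ι φ⁻¹ ((FramedRep.unitsContinuousMulEquivOfUnique (Fin 1) (PadicAlgCl p) :
      (PadicAlgCl p)ˣ →ₜ* GL (Fin 1) (PadicAlgCl p)).comp ψ⁻¹) := isPAdicAvatarOf_inv ι hr'
  have hκinv : FactorsThroughZp κ ((FramedRep.unitsContinuousMulEquivOfUnique (Fin 1) (PadicAlgCl p) :
      (PadicAlgCl p)ˣ →ₜ* GL (Fin 1) (PadicAlgCl p)).comp ψ⁻¹) := by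
    rw [factorsThroughZp_unitsChar_iff] at hκr' ⊢
    intro σ hσ
    rw [unitsChar_inv_apply, hκr' σ hσ, inv_one]
  have hjm : n - 1 < n + 1 := by omega
  have hinf : (reflect θK⁻¹ * φ⁻¹).HasInfinityType
      (fun _ ↦ -((n + 1 : ℕ) : ℤ)) (fun _ ↦ ((n - 1 : ℕ) : ℤ)) := by
    refine hasInfinityType_reflect_inv_mul
      (Three.LambdaSupply.hasInfinityType_zero_of_isFiniteOrder hfin) hn1 ?_
    convert hφinf.inv using 2 <;> simp
  have hunr : ∀ w' : HeightOneSpectrum (𝓞 K), w' ∉ S → w' ≠ vbar →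
      (reflect θK⁻¹ * φ⁻¹).IsUnramifiedAt w' := fun w' hw' _ ↦
    isUnramifiedAt_reflect_inv_mul_inv hgal hφunr (not_not.mp ((hS w').not.mp hw'))
  have hLb : LFunction.HasEntireContinuation (heckeLFunction (reflect θK⁻¹ * φ⁻¹)) :=
    hasEntireContinuation_reflect_inv_mul_inv hgal hφc hL
  -- read the branch there
  have hval := hQ.hasValueAt hinv hκinv hjm hinf hunr hLb
  -- the point is `r(γ) − 1`, the `L`-value is `L(θ_Kφ, 1)`, the exponent is `2n`
  have hpt : avatarValueAt ((FramedRep.unitsContinuousMulEquivOfUnique (Fin 1) (PadicAlgCl p) :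
      (PadicAlgCl p)ˣ →ₜ* GL (Fin 1) (PadicAlgCl p)).comp ψ⁻¹) γ⁻¹ = avatarValueAt r γ := by
    rw [avatarValueAt_unitsChar_inv, hre]
    have h := avatarValueAt_mul r γ γ⁻¹
    rw [mul_inv_cancel, avatarValueAt_one] at h
    exact inv_eq_of_mul_eq_one_left h.symm
  have hmj : n + 1 + (n - 1) = 2 * n := by omega
  rw [hpt, continuation_reflect_inv_mul_inv_zero hgal hφc hL hLb, hmj] at hval
  -- THE FACTOR
  have hS' : ∀ w' ∈ S, ¬ θK.IsUnramifiedAt w' := fun w' hw' ↦ (hS w').mp hw'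
  have hvbarS : vbar ∉ S := fun h ↦ (hS vbar).mp h hθvbar
  have hfac := katzInterpolationValue_eq_mul_interpolationValue hK hp hv hvbar hne hgal hθv hθvbar hφc
    hφunr hS' hvbarS hn1 Ω hδ (hL.continuation 1)
  -- rescale by `c₀`
  have hQval := intSeries_hasValueAt_C_mul c₀ hval
  have key : ((ι.symm (katzInterpolationValue p θK v vbar ∅ φ n Ω (hL.continuation 1)) :
        PadicAlgCl p) : ℂ_[p]) * (Ωp * w⁻¹) ^ (2 * n) =
      (c₀ : ℂ_[p]) * (((ι.symm (interpolationValue p v vbar S (reflect θK⁻¹ * φ⁻¹) (n + 1) (n - 1) Ω δ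
        (hL.continuation 1)) : PadicAlgCl p) : ℂ_[p]) * Ωp ^ (2 * n)) := by
    rw [hfac, hc₀, hΦ, hΦ, hΦ, ← hζ]
    have hw' : w ^ 2 = Φ ζ := by rw [← hΦ]; exact hw
    obtain ⟨m, rfl⟩ : ∃ m, n = m + 1 := ⟨n - 1, by omega⟩
    rw [Nat.add_sub_cancel]
    have hζ0 : Φ ζ ≠ 0 := by
      intro h0
      rw [h0] at hw'
      exact hw0 (pow_eq_zero_iff two_ne_zero |>.mp hw')
    simp only [map_mul, map_pow, map_inv₀]
    have hw2 : w⁻¹ ^ 2 = (Φ ζ)⁻¹ := by rw [← hw', inv_pow]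
    rw [mul_pow, show (w⁻¹) ^ (2 * (m + 1)) = ((w⁻¹) ^ 2) ^ (m + 1) by rw [← pow_mul], hw2]
    have hζinv : Φ ζ ^ m * (Φ ζ)⁻¹ ^ (m + 1) = (Φ ζ)⁻¹ := by
      rw [pow_succ, ← mul_assoc, ← mul_pow, mul_inv_cancel₀ hζ0, one_pow, one_mul]
    linear_combination (Φ 4 * Φ (interpolationValue p v vbar S (reflect θK⁻¹ * φ⁻¹) (m + 1 + 1) m Ω δ
      (hL.continuation 1)) * Ωp ^ (2 * (m + 1))) * hζinv
  rw [key]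
  exact hQval

/-! ## §2 The constants: `ζ⁴ = 1`, a square root `w` of `ι⁻¹ζ` in `ℂ_p`, and the unit `ι⁻¹(4ζ⁻¹)` -/

omit [IsCMField K] [Fact p.Prime] in
/-- **`ζ⁴ = 1`** for `ζ = (2πi/√D_K)/(2π/δ) = iδ/√D_K` and `δ² = ±D_K`: `ζ² = −δ²/D_K = ∓1`.
[cite: deShalit1987, II.4.14 (36) (the factor `(2π/√d_K)^j`, `δ` a square root of `±d_K`)]
[cite: Kriz2016, Thm. 27 (the factor `(2πi/√D_K)`)] -/
theorem zeta_pow_four_eq_one (hD : (NumberField.discr K : ℂ) ≠ 0) {δ : ℂ}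
    (hδ : δ ^ 2 = (NumberField.discr K : ℂ) ∨ δ ^ 2 = -(NumberField.discr K : ℂ)) :
    ((2 * (Real.pi : ℂ) * Complex.I / ((NumberField.discr K : ℂ) ^ ((2 : ℂ)⁻¹))) /
        (2 * (Real.pi : ℂ) / δ)) ^ 4 = 1 := by
  set s : ℂ := (NumberField.discr K : ℂ) ^ ((2 : ℂ)⁻¹) with hs
  have hs2 : s ^ 2 = (NumberField.discr K : ℂ) := by
    rw [hs, show ((2 : ℂ)⁻¹) = ((2 : ℕ) : ℂ)⁻¹ by norm_num]
    exact Complex.cpow_nat_inv_pow _ two_ne_zero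
  have hs0 : s ≠ 0 := by
    intro h
    apply hD
    rw [← hs2, h]
    ring
  have hδ0 : δ ≠ 0 := by
    rintro rfl
    rcases hδ with h | h
    · exact hD (by simpa using h.symm)
    · exact hD (by simpa using h.symm)
  have hπ : (2 * (Real.pi : ℂ)) ≠ 0 :=
    mul_ne_zero two_ne_zero (Complex.ofReal_ne_zero.mpr Real.pi_ne_zero)
  have hζ : (2 * (Real.pi : ℂ) * Complex.I / s) / (2 * (Real.pi : ℂ) / δ) = Complex.I * δ / s := by
    field_simp
  have h4 : (Complex.I * δ / s) ^ 4 = (δ ^ 2) ^ 2 / (s ^ 2) ^ 2 := by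
    rw [div_pow, mul_pow, Complex.I_pow_four, one_mul]
    ring
  rw [hζ, h4, hs2]
  rcases hδ with h | h
  · rw [h]
    field_simp
  · rw [h, neg_sq]
    field_simp

omit [IsCMField K] in
/-- **The constants of the dictionary are `p`-adic units** (`p` odd): for `ζ ∈ ℂ` with `ζ⁴ = 1` there
are `w ∈ ℂ_p` with `w² = ι⁻¹ζ`, `‖w‖ = 1` (`ℚ̄_p` is algebraically closed; `‖ι⁻¹ζ‖⁴ = 1`) and
`c₀ = ι⁻¹(4ζ⁻¹) ∈ 𝓞_{ℂ_p}` with `‖c₀‖ = 1` (`‖4‖_p = 1` for `p ≠ 2`). [folklore] -/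
theorem exists_frame_constants (hp2 : p ≠ 2) (ι : PadicAlgCl p ≃+* ℂ) {ζ : ℂ} (hζ4 : ζ ^ 4 = 1) :
    ∃ (w : ℂ_[p]) (c₀ : 𝓞_ℂ_[p]), w ^ 2 = ((ι.symm ζ : PadicAlgCl p) : ℂ_[p]) ∧ ‖w‖ = 1 ∧
      (c₀ : ℂ_[p]) = ((ι.symm (4 * ζ⁻¹) : PadicAlgCl p) : ℂ_[p]) ∧ ‖(c₀ : ℂ_[p])‖ = 1 := by
  have hp : p.Prime := Fact.out
  -- `z = ι⁻¹ζ` has norm `1`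
  set z : PadicAlgCl p := ι.symm ζ with hz
  have hz4 : z ^ 4 = 1 := by rw [hz, ← map_pow, hζ4, map_one]
  have hzn : ‖(z : ℂ_[p])‖ = 1 := by
    have h : ‖(z : ℂ_[p])‖ ^ 4 = 1 := by
      rw [← norm_pow, PadicComplex.coe_eq, ← map_pow, hz4, map_one, norm_one]
    exact (pow_eq_one_iff_of_nonneg (norm_nonneg _) (by norm_num)).mp h
  have hz0 : (z : ℂ_[p]) ≠ 0 := fun h ↦ by
    rw [h, norm_zero] at hzn
    exact zero_ne_one hzn
  -- a square root in `ℚ̄_p`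
  obtain ⟨w₀, hw₀⟩ := IsAlgClosed.exists_pow_nat_eq z (by norm_num : 0 < 2)
  have hw : ((w₀ : PadicAlgCl p) : ℂ_[p]) ^ 2 = (z : ℂ_[p]) := by
    rw [PadicComplex.coe_eq, PadicComplex.coe_eq, ← map_pow, hw₀]
  have hwn : ‖((w₀ : PadicAlgCl p) : ℂ_[p])‖ = 1 := by
    have h : ‖((w₀ : PadicAlgCl p) : ℂ_[p])‖ ^ 2 = 1 := by rw [← norm_pow, hw, hzn]
    exact (pow_eq_one_iff_of_nonneg (norm_nonneg _) (by norm_num)).mp h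
  -- the constant `ι⁻¹(4ζ⁻¹) = 4 · (ι⁻¹ζ)⁻¹`
  have h4 : ‖(4 : ℂ_[p])‖ = 1 := by
    rw [show (4 : ℂ_[p]) = algebraMap ℚ_[p] ℂ_[p] 4 from (map_ofNat _ 4).symm, norm_algebraMap',
      show (4 : ℚ_[p]) = ((4 : ℕ) : ℚ_[p]) by norm_num, Padic.norm_natCast_eq_one_iff]
    have h2 : p.Coprime 2 := (Nat.coprime_primes hp Nat.prime_two).mpr hp2
    simpa using h2.pow_right 2
  have hc : ((ι.symm (4 * ζ⁻¹) : PadicAlgCl p) : ℂ_[p]) = 4 * (z : ℂ_[p])⁻¹ := by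
    rw [PadicComplex.coe_eq, PadicComplex.coe_eq, map_mul, map_inv₀, map_mul, map_inv₀, map_ofNat,
      map_ofNat]
  have hcn : ‖((ι.symm (4 * ζ⁻¹) : PadicAlgCl p) : ℂ_[p])‖ = 1 := by
    rw [hc, norm_mul, norm_inv, h4, hzn, inv_one, mul_one]
  refine ⟨(w₀ : ℂ_[p]), ⟨((ι.symm (4 * ζ⁻¹) : PadicAlgCl p) : ℂ_[p]),
    mem_padicComplexInt_iff.mpr hcn.le⟩, hw, hwn, rfl, hcn⟩

/-! ## §3 AN-F₁, θ_K-explicit: the assembly from a two-variable de Shalit frame of `θ_K⁻¹` -/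

/-- **AN-F₁ (θ_K-explicit form) — the anticyclotomic line of the two-variable measure IS a CGLS-type
frame of `θ_K` over `𝓞_{ℂ_p}⟦T⟧, with first unit coefficient at `ord(g(S=0) mod p)`.** See the module
docstring for the statement and the route. GRANTED de Shalit II.6.4 (`hF`, PUBLISHED, a hypothesis).
Hypotheses on `θ_K` displayed: finite order, `c`-invariant, unramified at `v` and `v̄`, `S` its exact
ramification set. `Ω_K' := Ω`, `Ω_p' := Ω_p·w⁻¹` (`w² = ι⁻¹ζ`), `Q := C(ι⁻¹(4ζ⁻¹))·Ǧ(·,0)`.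
[cite: deShalit1987, II.6.4 Theorem (i) (9), (14)–(15); II.4.16 (49)–(50); II.6.1 (1)]
[cite: CastellaGrossiLeeSkinner2022, Thm. 2.1.2 (arXiv:2008.02571v2 TeX L1015–1041)] [cite: Kriz2016, Thm. 27]
[cite: Katz1978, Thm. (5.3.0) eq. (5.3.5)] [cite: Washington1997, §7.1 Prop. 7.2] -/
theorem exists_katzLineIntFrame (hF : thmII64_katzMeasure₂_functionalEquation)
    (hK : IsImaginaryQuadratic K) (hp : 2 < p)
    {ι : PadicAlgCl p ≃+* ℂ} {v vbar : HeightOneSpectrum (𝓞 K)} (hv : ((p : ℕ) : 𝓞 K) ∈ v.asIdeal)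
    (hvbar : ((p : ℕ) : 𝓞 K) ∈ vbar.asIdeal) (hne : vbar ≠ v)
    (hι : ∀ (w : InfinitePlace K) (k : 𝓞 K), k ∈ v.asIdeal ↔ ‖ι.symm (w.embedding (k : K))‖ < 1)
    {κ κ' : ZpExtension K p} (hκ : κ.IsAnticyclotomic) {γ γ' : absoluteGaloisGroup K}
    (hγ : κ.IsTopGenerator γ) (hpair : ZpExtension.IsTopGeneratorPair κ κ' γ γ')
    {θK : HeckeCharacter K} (hfin : θK.IsFiniteOrder)
    (hgal : HeckeCharacter.galConj (IsCMField.complexConj K) θK = θK)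
    (hθv : θK.IsUnramifiedAt v) (hθvbar : θK.IsUnramifiedAt vbar)
    {S : Finset (HeightOneSpectrum (𝓞 K))}
    (hS : ∀ w : HeightOneSpectrum (𝓞 K), w ∈ S ↔ ¬ θK.IsUnramifiedAt w)
    {Ω δ : ℂ} {Ωp : (unrIntegers p)ˣ} {G : PowerSeries (PowerSeries 𝓞_ℂ_[p])} (hΩ : Ω ≠ 0)
    (hδ : δ ^ 2 = (NumberField.discr K : ℂ) ∨ δ ^ 2 = -(NumberField.discr K : ℂ))
    (hG : IsKatzMeasure₂ ι v vbar S κ κ' γ⁻¹ γ'⁻¹ θK⁻¹ Ω δ ((Ωp : unrIntegers p) : ℂ_[p]) G)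
    {g : IwasawaAlgebra₂ p} {J : ℤ_[p] →+* 𝓞_ℂ_[p]}
    (hJ : ∀ x : ℤ_[p], ((J x : 𝓞_ℂ_[p]) : ℂ_[p]) = ((x : ℚ_[p]) : ℂ_[p]))
    (hassoc : Associated (PowerSeries.map (PowerSeries.map J) g) G)
    (hg0 : (g.map (PowerSeries.constantCoeff (R := ℤ_[p]))).map (IsLocalRing.residue ℤ_[p]) ≠ 0) :
    ∃ (ΩK' : ℂ) (Ωp' : ℂ_[p]) (Q : PowerSeries 𝓞_ℂ_[p]), ΩK' ≠ 0 ∧ ‖Ωp'‖ = 1 ∧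
      (∀ (φ : HeckeCharacter K) (n : ℕ), 0 < n → (p - 1) ∣ n →
        (∀ w : HeightOneSpectrum (𝓞 K), φ.IsUnramifiedAt w) →
        φ.HasInfinityType (fun _ ↦ (n : ℤ)) (fun _ ↦ -(n : ℤ)) →
        ∀ (hL : LFunction.HasEntireContinuation (heckeLFunction (θK * φ))),
        ∀ r : FramedGaloisRep K (PadicAlgCl p) 1, IsPAdicAvatarOf ι φ r → FactorsThroughZp κ r →
          IntSeries.HasValueAt Q (avatarValueAt r γ - 1)
            (((ι.symm (katzInterpolationValue p θK v vbar ∅ φ n ΩK' (hL.continuation 1)) :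
                PadicAlgCl p) : ℂ_[p]) * Ωp' ^ (2 * n))) ∧
      (‖((PowerSeries.coeff ((g.map (PowerSeries.constantCoeff (R := ℤ_[p]))).map
            (IsLocalRing.residue ℤ_[p])).order.toNat Q : 𝓞_ℂ_[p]) : ℂ_[p])‖ = 1 ∧
        ∀ i < ((g.map (PowerSeries.constantCoeff (R := ℤ_[p]))).map
            (IsLocalRing.residue ℤ_[p])).order.toNat,
          ‖((PowerSeries.coeff i Q : 𝓞_ℂ_[p]) : ℂ_[p])‖ < 1) := by
  have hprime : p.Prime := Fact.out
  have hp2 : p ≠ 2 := by omega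
  -- `θ_K⁻¹`: algebraic, unramified at `v`, `v̄`, ramified exactly on `S`
  have hvS : v ∉ S := fun h ↦ (hS v).1 h hθv
  have hvbarS : vbar ∉ S := fun h ↦ (hS vbar).1 h hθvbar
  have hlam : (θK⁻¹).IsAlgebraic :=
    HeckeCharacter.IsFiniteOrder.isAlgebraic (show IsOfFinOrder θK⁻¹ from IsOfFinOrder.inv hfin)
  have hprim : ∀ w ∈ S, ¬ (θK⁻¹).IsUnramifiedAt w := fun w hw h ↦ (hS w).1 hw (by
    have h' := h.inv'
    rwa [inv_inv] at h')
  have hunr : ∀ w : HeightOneSpectrum (𝓞 K), w ∉ S → w ≠ v → w ≠ vbar → (θK⁻¹).IsUnramifiedAt w :=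
    fun w hw _ _ ↦ (not_not.1 ((hS w).not.1 hw)).inv'
  -- (F) on the anticyclotomic line at the inverse generators
  obtain ⟨Gc, C₁, g₀, -, hGcB, hC₁, hrel⟩ := hF.anticyclotomicLine_left hK hv hvbar hne hι hΩ hδ hvS
    hvbarS hlam hθv.inv' hθvbar.inv' hprim hunr hpair.isUnitGeneratorPair_inv hκ hG
  rw [image_complexConj_eq_of_galConj_eq hgal hS] at hGcB
  -- the constants
  have hD : (NumberField.discr K : ℂ) ≠ 0 := by exact_mod_cast NumberField.discr_ne_zero K
  have hδ0 : δ ≠ 0 := by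
    rintro rfl
    rcases hδ with h | h
    · exact hD (by simpa using h.symm)
    · exact hD (by simpa using h.symm)
  obtain ⟨w, c₀, hw, hwn, hc₀, hc₀n⟩ := exists_frame_constants hp2 ι (zeta_pow_four_eq_one hD hδ)
  have hw0 : w ≠ 0 := fun h ↦ by
    rw [h, norm_zero] at hwn
    exact zero_ne_one hwn
  refine ⟨Ω, ((Ωp : unrIntegers p) : ℂ_[p]) * w⁻¹,
    PowerSeries.C c₀ * PowerSeries.map (PowerSeries.constantCoeff (R := 𝓞_ℂ_[p])) Gc, hΩ, ?_, ?_, ?_⟩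
  · rw [norm_mul, norm_inv, hwn, inv_one, mul_one]
    exact Halves.norm_coe_units_unrIntegers p Ωp
  · intro φ n hn _ hφunr hφinf hL r hr hκr
    exact hasValueAt_C_mul_of_isKatzBranch_reflect_inv hK hv hvbar hne hfin hgal hθv hθvbar hS hκ hδ0
      hGcB hw hw0 hc₀ φ n hn hφunr hφinf hL r hr hκr
  · -- the first-unit index: `G(·,0) = C·(1+T)^a·Ǧ(·,0)` and `J(g(·,0)) ~ G(·,0)`
    have hGs := eq_C_mul_binomial_mul_of_relation hp2 hK ι hκ hγ hJ hC₁ g₀ hrel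
    have e : PowerSeries.map (PowerSeries.constantCoeff (R := 𝓞_ℂ_[p]))
        (PowerSeries.map (PowerSeries.map J) g) =
        PowerSeries.map J (g.map (PowerSeries.constantCoeff (R := ℤ_[p]))) := by
      ext n
      simp only [PowerSeries.coeff_map, ← PowerSeries.coeff_zero_eq_constantCoeff_apply]
    have hassoc' : Associated (PowerSeries.map J (g.map (PowerSeries.constantCoeff (R := ℤ_[p]))))
        (PowerSeries.map (PowerSeries.constantCoeff (R := 𝓞_ℂ_[p])) G) := by
      rw [← e]
      exact hassoc.map (PowerSeries.map (PowerSeries.constantCoeff (R := 𝓞_ℂ_[p])))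
    have h1 := firstUnit_of_associated_map hJ hassoc' hg0
    rw [hGs, firstUnit_C_mul_iff (c := ⟨C₁, mem_padicComplexInt_iff.mpr hC₁.le⟩) hC₁,
      firstUnit_mul_iff_of_isUnit (isUnit_binomialSeries_map_int J _)] at h1
    exact (firstUnit_C_mul_iff hc₀n _ _).mpr h1

end Summit.BirchSwinnertonDyer.BirchSwinnertonDyer.Theorems.KatzLineFrame

end
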